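import Mathlib
import HarnessLib

/-!
# Venture HSemireg — the fibre test is blind to split sums: if `N` and `K` pass (F3), so does `N ⊕ K[m]`

HONEST FRAMING. Lean leaf for the computation cell `pub-hsemireg` (theory seat th-3 gen 25; files of
record `run/shared/lean/pub/pub-hsemireg/theory/TH3-FIBRE-LEVEL-READ.md` §1 and
`target-g6/GRID-BARRIER-t5g9.md` §16.6, 2026-08-23; the statement is pencil ×2 and machine ×2 across
seats there). The «full (F3) fibre test» of a hypothetical (β)-object fibre `F` asks, inside the Yoneda
algebra `Ext^•(F,F)` with its translation classes `τ_j` and volume class `vol`, for classes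
`κ₁, …, κ_n` with `κ_i τ_j = 0`, `κ_i² = 0`, `κ_i κ_j + κ_j κ_i = 0` (an exterior `n`-plane) and
`κ₁ ⋯ κ_n = c · vol`, `c ≠ 0`. For a split sum `F = N ⊕ K[m]` the algebra `Ext(F,F)` contains the
product algebra `Ext(N,N) × Ext(K,K)` block-diagonally, on which the translation classes and `vol`
are diagonal; so certificates for `N` and `K` combine — after rescaling one class of the second block
so that the two constants agree — into a certificate for `F`. THIS FILE kernel-checks exactly that
algebraic step (`fibreTest_pass_prod`), for arbitrary (possibly non-commutative) algebras `A`, `B` over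
a field in place of the two Ext algebras, together with the bookkeeping lemma that a product over
`Fin (n+1)` in `A × B` is computed componentwise (`prod_ofFn_fst`, `prod_ofFn_snd`). CONSEQUENCE
recorded in the notes (not formalised here): with the c.i. criterion of `FibreTestCICriterion.lean`
the Euler characteristics `48 − 45 = 3`, `60 − 54 = 6`, `48 − 36 = 12` of split sums of passing
monomial complete intersections show that NO threshold on `|χ|` can make the fibre test fail — the
test alone does not close case (β). The identification of the product algebra with a subalgebra of
`Ext(N ⊕ K[m], N ⊕ K[m])` (HKR/Koszul dictionary) is NOT formalised. No object is constructed; nothing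
here bears on HC, HC_CM or HC_AV.
-/

namespace Summit.Ventures.HSemireg

section ProdBookkeeping

variable {A B : Type*} [Monoid A] [Monoid B] {n : ℕ}

/-- The first component of a `List.ofFn` product in `A × B` is the product of the first components.
[folklore] -/
theorem prod_ofFn_fst (κ : Fin n → A × B) :
    (List.ofFn κ).prod.1 = (List.ofFn fun i => (κ i).1).prod := by
  have h := map_list_prod (MonoidHom.fst A B) (List.ofFn κ)
  rw [List.map_ofFn] at h
  exact h

/-- The second component of a `List.ofFn` product in `A × B` is the product of the second components.
[folklore] -/
theorem prod_ofFn_snd (κ : Fin n → A × B) :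
    (List.ofFn κ).prod.2 = (List.ofFn fun i => (κ i).2).prod := by
  have h := map_list_prod (MonoidHom.snd A B) (List.ofFn κ)
  rw [List.map_ofFn] at h
  exact h

end ProdBookkeeping

section Rescale

variable {K : Type*} [Field K] {B : Type*} [Ring B] [Algebra K B] {n : ℕ}

/-- Rescaling the first class of a certificate rescales the total product. [folklore] -/
theorem prod_ofFn_update_zero_smul (κ : Fin (n + 1) → B) (a : K) :
    (List.ofFn fun i => if i = 0 then a • κ i else κ i).prod = a • (List.ofFn κ).prod := by
  rw [List.ofFn_succ, List.ofFn_succ, List.prod_cons, List.prod_cons]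
  simp only [↓reduceIte, Fin.succ_ne_zero]
  rw [smul_mul_assoc]

end Rescale

section SplitSum

variable {K : Type*} [Field K] {A B : Type*} [Ring A] [Ring B] [Algebra K A] [Algebra K B] {n : ℕ}

/-- **Split sums pass when the summands pass (the ⊕-lemma of TH3-FIBRE-LEVEL-READ §1 /
GRID-BARRIER §16.6, abstract form).** Let `A`, `B` be algebras over a field `K` (standing for
`Ext(N,N)` and `Ext(K',K')`), with «translation» elements `τA`, `τB`, «volume» elements `vA`, `vB`,
and exterior certificates `κA`, `κB` of `n + 1` classes each: orthogonal to the translations, squaring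
to zero, pairwise anticommuting, with products `cA • vA`, `cB • vB`, `cA, cB ≠ 0`. Then the product
algebra `A × B` with the diagonal translations `(τA j, τB j)` and diagonal volume `(vA, vB)` carries an
exterior certificate with constant `cA` — namely `(κA i, κB' i)` where `κB'` is `κB` with its first
class rescaled by `cA / cB`. [folklore] -/
theorem fibreTest_pass_prod (τA : Fin (n + 1) → A) (τB : Fin (n + 1) → B) (vA : A) (vB : B)
    (κA : Fin (n + 1) → A) (cA : K) (hcA : cA ≠ 0)
    (hAτ : ∀ i j, κA i * τA j = 0) (hAsq : ∀ i, κA i * κA i = 0)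
    (hAac : ∀ i j, κA i * κA j + κA j * κA i = 0) (hAprod : (List.ofFn κA).prod = cA • vA)
    (κB : Fin (n + 1) → B) (cB : K) (hcB : cB ≠ 0)
    (hBτ : ∀ i j, κB i * τB j = 0) (hBsq : ∀ i, κB i * κB i = 0)
    (hBac : ∀ i j, κB i * κB j + κB j * κB i = 0) (hBprod : (List.ofFn κB).prod = cB • vB) :
    ∃ κ : Fin (n + 1) → A × B,
      (∀ i j, κ i * (τA j, τB j) = 0) ∧ (∀ i, κ i * κ i = 0) ∧
      (∀ i j, κ i * κ j + κ j * κ i = 0) ∧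
      ∃ c : K, c ≠ 0 ∧ (List.ofFn κ).prod = c • (vA, vB) := by
  set κB' : Fin (n + 1) → B := fun i => if i = 0 then (cA / cB) • κB i else κB i with hκB'
  have hB'τ : ∀ i j, κB' i * τB j = 0 := by
    intro i j
    by_cases hi : i = 0
    · simp only [hκB', hi, ↓reduceIte, smul_mul_assoc, hBτ, smul_zero]
    · simp only [hκB', hi, ↓reduceIte, hBτ]
  have hB'sq : ∀ i, κB' i * κB' i = 0 := by
    intro i
    by_cases hi : i = 0
    · simp only [hκB', hi, ↓reduceIte, smul_mul_assoc, mul_smul_comm, hBsq, smul_zero]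
    · simp only [hκB', hi, ↓reduceIte, hBsq]
  have hB'ac : ∀ i j, κB' i * κB' j + κB' j * κB' i = 0 := by
    intro i j
    by_cases hi : i = 0
    · by_cases hj : j = 0
      · subst hi; subst hj
        have := hB'sq 0
        rw [this, add_zero]
      · simp only [hκB', hi, hj, ↓reduceIte, smul_mul_assoc, mul_smul_comm, ← smul_add, hBac,
          smul_zero]
    · by_cases hj : j = 0
      · simp only [hκB', hi, hj, ↓reduceIte, smul_mul_assoc, mul_smul_comm, ← smul_add, hBac,
          smul_zero]
      · simp only [hκB', hi, hj, ↓reduceIte, hBac]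
  have hB'prod : (List.ofFn κB').prod = cA • vB := by
    rw [hκB', prod_ofFn_update_zero_smul, hBprod, smul_smul, div_mul_cancel₀ _ hcB]
  refine ⟨fun i => (κA i, κB' i), ?_, ?_, ?_, cA, hcA, ?_⟩
  · intro i j
    rw [Prod.mk_mul_mk, hAτ, hB'τ, Prod.mk_zero_zero]
  · intro i
    rw [Prod.mk_mul_mk, hAsq, hB'sq, Prod.mk_zero_zero]
  · intro i j
    rw [Prod.mk_mul_mk, Prod.mk_mul_mk, Prod.mk_add_mk, hAac, hB'ac, Prod.mk_zero_zero]
  · apply Prod.ext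
    · rw [prod_ofFn_fst]
      simpa using hAprod
    · rw [prod_ofFn_snd]
      simpa using hB'prod

end SplitSum

end Summit.Ventures.HSemireg
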